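import Summits.Schanuel.Schanuel.Theorems.ZilberEacDegenerateDirectionEstimates
import HarnessLib

/-!
# The exponential-polynomial regime, CX (a): THE EDGE DATA of a degenerate fibre relation along a
# place, and the polynomial perturbation bound

HONEST FRAMING.  Cell `pub-schanuel` (Zilber's Exponential-Algebraic Closedness, case ladder;
host summit Schanuel), seat 2, gen 34.  Infrastructure for file CX (b).  Given the base curve
`F = 0`, a place `x₀ = s^{-k}`, `x₁ = Φ(s)s^{-M}`, the degenerate fibre relation
`G₀ ∈ ℂ[x₀][x₁][y₀]` (the fibre relation with `y₁ = 0`) and its Puiseux root `ψ(σ)σ^L`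
(`s = σ^e`, file XCII), **`exists_edgeData`** produces the weight `ν ∈ ℤ` and analytic rows `α_i`
with `G₀(x(σ^e); σ^L Y) = σ^ν Σ_i α_i(σ) Y^i` for small `σ ≠ 0`, the edge polynomial
`E(Y) = Σ α_i(0) Y^i` vanishing at `ψ(0) ≠ 0` and not vanishing at some `Y ≠ 0` — the input of the
abstract perturbation theorem (file CVIII (b)).  **`exists_norm_polyMap_sub_le`**: the
perturbation `G(x, y₁; Y) − G(x, 0; Y)` is bounded by `C |y₁| X^N` when `|x_i|, |Y| ≤ X`,
`|y₁| ≤ 1`.  [folklore]; nothing here bears on Mantova–Masser's question (OPEN), EC(3,2) (OPEN)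
or Schanuel's conjecture (neither used nor implied); EAC ⇏ SC.
-/

noncomputable section

open Filter Topology Metric Complex Polynomial

set_option linter.dupNamespace false

namespace Summit.Schanuel.Schanuel.Theorems

/-! ## Part A. Small tools -/

/-- `σ ↦ σ^e` maps the punctured neighbourhood of `0` into itself (`e ≥ 1`). [folklore] -/
theorem tendsto_pow_puncturedNhds_zero (e : ℕ) (he : 1 ≤ e) :
    Tendsto (fun σ : ℂ => σ ^ e) (𝓝[≠] (0 : ℂ)) (𝓝[≠] (0 : ℂ)) :=
  tendsto_nhdsWithin_iff.2 ⟨(tendsto_pow_nhds_zero e he).mono_left nhdsWithin_le_nhds,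
    eventually_mem_nhdsWithin.mono fun _ hσ => pow_ne_zero _ hσ⟩

/-- A row `φ(σ)σ^m` with `φ(0) ≠ 0` is not eventually zero on the punctured neighbourhood.
[folklore] -/
theorem not_eventuallyNE_zero_of_row {Q φ : ℂ → ℂ} (hφ : ContinuousAt φ 0) (hφ0 : φ 0 ≠ 0)
    (m : ℤ) (hQ : ∀ᶠ σ in 𝓝[≠] (0 : ℂ), Q σ = φ σ * σ ^ m) :
    ¬ ∀ᶠ σ in 𝓝[≠] (0 : ℂ), Q σ = 0 := by
  intro h
  have h2 : ∀ᶠ σ in 𝓝[≠] (0 : ℂ), False := by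
    filter_upwards [hQ, h, nhdsWithin_le_nhds (hφ.eventually_ne hφ0), self_mem_nhdsWithin]
      with σ h1 h2 h3 h4
    rw [h2] at h1
    exact (mul_ne_zero h3 (zpow_ne_zero _ h4)) h1.symm
  exact h2.exists.elim fun _ h => h

/-- A function continuous at `0` vanishing on the punctured neighbourhood vanishes at `0`.
[folklore] -/
theorem eq_zero_of_eventuallyNE {g : ℂ → ℂ} (hg : ContinuousAt g 0)
    (h : ∀ᶠ σ in 𝓝[≠] (0 : ℂ), g σ = 0) : g 0 = 0 := by
  have h1 : Tendsto g (𝓝[≠] (0 : ℂ)) (𝓝 (g 0)) := hg.tendsto.mono_left nhdsWithin_le_nhds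
  have h2 : Tendsto g (𝓝[≠] (0 : ℂ)) (𝓝 0) :=
    (tendsto_const_nhds (x := (0 : ℂ))).congr' (h.mono fun σ hσ => hσ.symm)
  exact tendsto_nhds_unique h1 h2

/-! ## Part B. The polynomial perturbation bound -/

/-- **The perturbation bound for `G ∈ ℂ[x₀, x₁, y₁][y₀]`.**  There are `C > 0` and `N` with
`|G(v; Y) − G(w; Y)| ≤ C |v₂| X^N` whenever `w = (v₀, v₁, 0)`, `|v₀|, |v₁|, |Y| ≤ X` (`X ≥ 1`) and
`|v₂| ≤ 1`. [folklore] -/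
theorem exists_norm_polyMap_sub_le (G : Polynomial (MvPolynomial (Fin 3) ℂ)) :
    ∃ C > 0, ∃ N : ℕ, ∀ (v w : Fin 3 → ℂ) (X : ℝ) (Y : ℂ), w 0 = v 0 → w 1 = v 1 → w 2 = 0 →
      1 ≤ X → ‖v 0‖ ≤ X → ‖v 1‖ ≤ X → ‖v 2‖ ≤ 1 → ‖Y‖ ≤ X →
      ‖(G.map (MvPolynomial.eval v)).eval Y - (G.map (MvPolynomial.eval w)).eval Y‖ ≤
        C * ‖v 2‖ * X ^ N := by
  classical
  set d : ℕ := G.natDegree with hd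
  set B : ℝ := ∑ i ∈ Finset.range (d + 1), ∑ m ∈ (G.coeff i).support, ‖(G.coeff i).coeff m‖
    with hB
  set N : ℕ := ∑ i ∈ Finset.range (d + 1), ((G.coeff i).totalDegree + i) with hN
  have hB0 : 0 ≤ B := Finset.sum_nonneg fun i _ => coeffSum_nonneg _
  refine ⟨B + 1, by linarith, N, fun v w X Y hw0 hw1 hw2 hX h0 h1 h2 hY => ?_⟩
  rw [eval_map_eq_rowSum G _ le_rfl, eval_map_eq_rowSum G _ le_rfl, ← Finset.sum_sub_distrib]
  have hXN : ∀ i ∈ Finset.range (d + 1), X ^ ((G.coeff i).totalDegree + i) ≤ X ^ N := fun i hi =>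
    pow_le_pow_right₀ hX (Finset.single_le_sum (f := fun i => (G.coeff i).totalDegree + i)
      (fun _ _ => Nat.zero_le _) hi)
  calc ‖∑ i ∈ Finset.range (d + 1), (MvPolynomial.eval v (G.coeff i) * Y ^ i -
          MvPolynomial.eval w (G.coeff i) * Y ^ i)‖
      ≤ ∑ i ∈ Finset.range (d + 1), ‖MvPolynomial.eval v (G.coeff i) * Y ^ i -
          MvPolynomial.eval w (G.coeff i) * Y ^ i‖ := norm_sum_le _ _
    _ ≤ ∑ i ∈ Finset.range (d + 1),
          (∑ m ∈ (G.coeff i).support, ‖(G.coeff i).coeff m‖) * ‖v 2‖ * X ^ N := by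
        refine Finset.sum_le_sum fun i hi => ?_
        rw [← sub_mul, norm_mul, norm_pow]
        have hdiff := norm_eval₃_sub_le (G.coeff i) v w hw0 hw1 hw2 hX h0 h1 h2
        have hYi : ‖Y‖ ^ i ≤ X ^ i := pow_le_pow_left₀ (norm_nonneg _) hY i
        calc ‖MvPolynomial.eval v (G.coeff i) - MvPolynomial.eval w (G.coeff i)‖ * ‖Y‖ ^ i
            ≤ (‖v 2‖ * X ^ (G.coeff i).totalDegree * ∑ m ∈ (G.coeff i).support,
                ‖(G.coeff i).coeff m‖) * X ^ i :=
              mul_le_mul hdiff hYi (by positivity) (mul_nonneg (mul_nonneg (norm_nonneg _)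
                (pow_nonneg (by linarith) _)) (coeffSum_nonneg _))
          _ = (∑ m ∈ (G.coeff i).support, ‖(G.coeff i).coeff m‖) * ‖v 2‖ *
                X ^ ((G.coeff i).totalDegree + i) := by rw [pow_add]; ring
          _ ≤ (∑ m ∈ (G.coeff i).support, ‖(G.coeff i).coeff m‖) * ‖v 2‖ * X ^ N :=
              mul_le_mul_of_nonneg_left (hXN i hi) (mul_nonneg (coeffSum_nonneg _) (norm_nonneg _))
    _ = B * ‖v 2‖ * X ^ N := by rw [hB, Finset.sum_mul, Finset.sum_mul]
    _ ≤ (B + 1) * ‖v 2‖ * X ^ N := by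
        have : 0 ≤ ‖v 2‖ * X ^ N := mul_nonneg (norm_nonneg _) (pow_nonneg (by linarith) _)
        nlinarith

/-! ## Part C. The edge data of the degenerate relation along a place -/

section EdgeData

variable (F : ℂ[X][X])

/-- **The edge data.**  `F` irreducible of positive `x₁`-degree, a place `x₀ = s^{-k}`,
`x₁ = Φ(s)s^{-M}`, a relation `G₀ ∈ ℂ[x₀][x₁][y]` with `F ∤` (top coefficient), and a root germ
`ψ(σ)σ^L` (`s = σ^e`, `ψ(0) ≠ 0`).  Then there are `ν ∈ ℤ` and rows `α_i` analytic at `0` with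
`G₀(x(σ^e); σ^L Y) = σ^ν Σ_{i ≤ d} α_i(σ) Y^i` for small `σ ≠ 0` and all `Y`, the edge polynomial
`Σ α_i(0) Y^i` vanishes at `ψ(0)` and does not vanish at some `Y ≠ 0`. [folklore] (new) -/
theorem exists_edgeData (hFirr : Irreducible F) (hn : 1 ≤ F.natDegree) {k : ℕ} (hk : 1 ≤ k)
    (M : ℕ) {Φ : ℂ → ℂ} (hΦan : AnalyticAt ℂ Φ 0)
    (hplace : ∀ᶠ s in 𝓝[≠] (0 : ℂ),
      (F.map (Polynomial.evalRingHom (s ^ k)⁻¹)).eval (Φ s * (s ^ M)⁻¹) = 0)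
    (G₀ : Polynomial ℂ[X][X]) (htop : ¬ F ∣ G₀.leadingCoeff)
    {e : ℕ} (he : 1 ≤ e) (L : ℤ) {ψ : ℂ → ℂ} (hψan : AnalyticAt ℂ ψ 0)
    (hroot : ∀ᶠ σ in 𝓝[≠] (0 : ℂ),
      (G₀.map (Polynomial.eval₂RingHom (Polynomial.evalRingHom ((σ ^ e) ^ k)⁻¹)
        (Φ (σ ^ e) * ((σ ^ e) ^ M)⁻¹))).eval (ψ σ * σ ^ L) = 0) :
    ∃ (ν : ℤ) (α : ℕ → ℂ → ℂ), (∀ i, AnalyticAt ℂ (α i) 0) ∧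
      (∑ i ∈ Finset.range (G₀.natDegree + 1), α i 0 * ψ 0 ^ i = 0) ∧
      (∃ Y : ℂ, Y ≠ 0 ∧ ∑ i ∈ Finset.range (G₀.natDegree + 1), α i 0 * Y ^ i ≠ 0) ∧
      ∀ᶠ σ in 𝓝[≠] (0 : ℂ), ∀ Y : ℂ,
        (G₀.map (Polynomial.eval₂RingHom (Polynomial.evalRingHom ((σ ^ e) ^ k)⁻¹)
          (Φ (σ ^ e) * ((σ ^ e) ^ M)⁻¹))).eval (σ ^ L * Y) =
        σ ^ ν * ∑ i ∈ Finset.range (G₀.natDegree + 1), α i σ * Y ^ i := by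
  classical
  set d : ℕ := G₀.natDegree with hdG
  -- the place evaluation at `σ^e`
  set ev : ℂ → (ℂ[X][X] →+* ℂ) := fun σ =>
    Polynomial.eval₂RingHom (Polynomial.evalRingHom ((σ ^ e) ^ k)⁻¹)
      (Φ (σ ^ e) * ((σ ^ e) ^ M)⁻¹) with hev
  have hevF : ∀ σ (H : ℂ[X][X]), ev σ H =
      (H.map (Polynomial.evalRingHom ((σ ^ e) ^ k)⁻¹)).eval (Φ (σ ^ e) * ((σ ^ e) ^ M)⁻¹) := by
    intro σ H
    rw [hev]
    simp only [Polynomial.coe_eval₂RingHom, Polynomial.eval_map]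
  -- rows `Q i σ = ev σ (G₀.coeff i)`
  set Q : ℕ → ℂ → ℂ := fun i σ => ev σ (G₀.coeff i) with hQ
  have hpow := tendsto_pow_puncturedNhds_zero e he
  have hplaceσ : ∀ᶠ σ in 𝓝[≠] (0 : ℂ),
      (F.map (Polynomial.evalRingHom ((σ ^ e) ^ k)⁻¹)).eval (Φ (σ ^ e) * ((σ ^ e) ^ M)⁻¹) = 0 :=
    hpow.eventually hplace
  -- each row: zero (if `F ∣`) or of the form `φ σ^m`
  have hrows : ∀ i ∈ Finset.range (d + 1), (∀ᶠ σ in 𝓝[≠] (0 : ℂ), Q i σ = 0) ∨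
      ∃ (φ : ℂ → ℂ) (m : ℤ), AnalyticAt ℂ φ 0 ∧ φ 0 ≠ 0 ∧
        ∀ᶠ σ in 𝓝[≠] (0 : ℂ), Q i σ = φ σ * σ ^ m := by
    intro i _
    by_cases hdvd : F ∣ G₀.coeff i
    · left
      obtain ⟨H, hH⟩ := hdvd
      filter_upwards [hplaceσ] with σ hσ
      rw [hQ]
      simp only
      rw [hevF, hH, Polynomial.map_mul, Polynomial.eval_mul, hσ, zero_mul]
    · right
      obtain ⟨φ, m, hφan, hφ0, hφev⟩ := exists_row_along_place F hFirr hn hk M hΦan hplace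
        (G₀.coeff i)
      have he0 : (0 : ℂ) ^ e = 0 := zero_pow (by omega : e ≠ 0)
      refine ⟨fun σ => φ (σ ^ e), (e : ℤ) * m, ?_, ?_, ?_⟩
      · exact (hφan.comp_of_eq ((analyticAt_id.pow e)) (by simp [he0]))
      · show φ (0 ^ e) ≠ 0
        rw [he0]
        exact hφ0 hdvd
      · filter_upwards [hpow.eventually hφev, self_mem_nhdsWithin] with σ hσ hσ0
        rw [hQ]
        simp only
        rw [hevF, hσ, zpow_mul, zpow_natCast]
  have hne : ∃ i ∈ Finset.range (d + 1), ¬ ∀ᶠ σ in 𝓝[≠] (0 : ℂ), Q i σ = 0 := by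
    refine ⟨d, Finset.self_mem_range_succ d, ?_⟩
    obtain ⟨φ, m, hφan, hφ0, hφev⟩ := exists_row_along_place F hFirr hn hk M hΦan hplace
      (G₀.coeff d)
    have he0 : (0 : ℂ) ^ e = 0 := zero_pow (by omega : e ≠ 0)
    have hφ0' : (fun σ : ℂ => φ (σ ^ e)) 0 ≠ 0 := by
      show φ (0 ^ e) ≠ 0
      rw [he0]
      exact hφ0 htop
    refine not_eventuallyNE_zero_of_row (φ := fun σ => φ (σ ^ e))
      ((hφan.continuousAt.comp_of_eq (continuous_pow e).continuousAt (by simp [he0])))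
      hφ0' ((e : ℤ) * m) ?_
    filter_upwards [hpow.eventually hφev] with σ hσ
    rw [hQ]
    simp only
    rw [hevF, hσ, zpow_mul, zpow_natCast]
  obtain ⟨ν, α, hα, hα0, hid⟩ := exists_edgeRows d Q L hrows hne
  -- the identity for all `Y`
  have hall : ∀ᶠ σ in 𝓝[≠] (0 : ℂ), ∀ i ∈ Finset.range (d + 1),
      Q i σ * (σ ^ L) ^ i = σ ^ ν * α i σ :=
    (Filter.eventually_all_finset _).2 fun i hi => hid i hi
  have hsum : ∀ᶠ σ in 𝓝[≠] (0 : ℂ), ∀ Y : ℂ,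
      (G₀.map (ev σ)).eval (σ ^ L * Y) = σ ^ ν * ∑ i ∈ Finset.range (d + 1), α i σ * Y ^ i := by
    filter_upwards [hall] with σ hσ Y
    rw [eval_map_eq_rowSum G₀ (ev σ) le_rfl, Finset.mul_sum]
    refine Finset.sum_congr rfl fun i hi => ?_
    rw [mul_pow, ← mul_assoc, show (ev σ) (G₀.coeff i) = Q i σ from rfl, hσ i hi]
    ring
  refine ⟨ν, α, hα, ?_, exists_ne_zero_rowSum_ne_zero hα0, ?_⟩
  · -- the edge polynomial vanishes at `ψ(0)`: `Σ α_i(σ) ψ(σ)^i = 0` near `0`, continuity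
    have hz : ∀ᶠ σ in 𝓝[≠] (0 : ℂ), ∑ i ∈ Finset.range (d + 1), α i σ * ψ σ ^ i = 0 := by
      filter_upwards [hsum, hroot, self_mem_nhdsWithin] with σ hσ hr hσ0
      have h1 := hσ (ψ σ)
      rw [show σ ^ L * ψ σ = ψ σ * σ ^ L by ring] at h1
      rw [hev] at h1
      simp only at h1
      rw [hr] at h1
      have hσν : σ ^ ν ≠ 0 := zpow_ne_zero _ hσ0
      exact (mul_eq_zero.1 h1.symm).resolve_left hσν
    have hcont : ContinuousAt (fun σ => ∑ i ∈ Finset.range (d + 1), α i σ * ψ σ ^ i) 0 := by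
      refine tendsto_finsetSum _ fun i _ => ?_
      exact ((hα i).continuousAt).mul (hψan.continuousAt.pow i)
    exact eq_zero_of_eventuallyNE hcont hz
  · filter_upwards [hsum] with σ hσ Y
    rw [← hσ Y, hev]

end EdgeData

end Summit.Schanuel.Schanuel.Theorems

end
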